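import Summits.Ventures.HSemireg.WedgeHankelRecurrenceGaussChebyshevLevelSetAllPhases

/-!
# Venture HSemireg — **THE MULTIPLE-ANGLE SINE PRODUCT `∏_{j<n} 2sin(θ + πj∕n) = 2sin(nθ)`, i.e. `sin(nθ) = 2^{n−1} ∏_{j<n} sin(θ + πj∕n)`, for ALL `θ ∈ ℝ`** (`n ≥ 1`), with the squared form
# `∏_{j<n} (2 − 2cos((φ + 2πj)∕n)) = 2 − 2cos φ` (`= C_n(2) − 2cos φ`, N517 at `X = 2`), the cosine companion `∏_{j<n} 2cos(θ + πj∕n) = 2sin(nθ + nπ∕2)` and `cos(nθ) = 2^{n−1} ∏_{j<n} sin(θ + (2j+1)π∕2n)`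

HONEST FRAMING. Part of the Lean index of the computation cell `pub-hsemireg` (seat p10 gen 49, Sunday typer «UNIFORM-IN-n»).  Real trigonometry only (Mathlib `Real.sin ∕ cos`, `Int.floor`) on top of the
polynomial identity of N517; no variety, no cohomology theory, no sheaf, no Ext group and no semiregularity map is constructed here; nothing here says that HC / HC_CM / HC_AV holds; no Literature fact
(unproved `Prop`) is declared or used.  Custodian versions as in `WedgeHankelSiegelIdeal` (1/3).
SOURCES (cited).  I. S. Gradshteyn, I. M. Ryzhik, *Table of Integrals, Series, and Products*, §1.39 (`sin nx = 2^{n−1} ∏_{k=0}^{n−1} sin(x + kπ∕n)`); E. W. Hobson, *A Treatise on Plane Trigonometry* (7th ed.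
1928), Ch. VII §§85–86; T. J. Rivlin, *The Chebyshev Polynomials* (1974), §1.2.
PROOF TYPED HERE.  (1) N517 `chebyshevC_sub_C_two_mul_cos_eq_prod_real` at `X = 2` (`C_n(2) = 2`) gives the squared identity `∏ 4sin²(θ + πj∕n) = 4sin²(nθ)`; (2) on `[0, π∕n]` every factor and
`sin(nθ)` are `≥ 0`, so the square root is unambiguous (`pow_left_inj₀`); (3) the SHIFT RULE `∏_{j<n} 2sin(θ + π∕n + πj∕n) = −∏_{j<n} 2sin(θ + πj∕n)` (reindex `j ↦ j+1`, `sin(θ + π) = −sin θ`;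
`Finset.prod_range_succ ∕ succ'`) and `sin(nθ + π) = −sin(nθ)` transport the identity from `[0, π∕n]` to `[kπ∕n, (k+1)π∕n]` for every `k ∈ ℤ` (two inductions on `k ∈ ℕ`), i.e. to all of `ℝ`
(`Int.floor`, `Int.eq_nat_or_neg`).
DEDUP DISCLOSURE (`rg -n 'sin_nat_mul|prod.*sin \\(.*\\+|MultipleAngle' Summits Literature`, `lean search sin multiple angle product`, 2026-09-04): Mathlib has `Complex.sin`/`cos` multiple-angle
formulas via Chebyshev (`T_real_cos`, `U_real_cos`) and Euler's infinite product, but not the finite shifted product; the tree has the special values N510–N512, N516 only; 0 hits for the 8 names below.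

WHAT IS IN THE TREE.  N517 `chebyshevC_sub_C_two_mul_cos_eq_prod_real`; Mathlib `C_eval_two`, `Real.sin_add_pi`, `Real.sin_add_pi_div_two`, `Real.sin_nonneg_of_nonneg_of_le_pi`, `pow_left_inj₀`,
`Int.floor_le ∕ lt_floor_add_one`, `Int.eq_nat_or_neg`.
THIS FILE (namespace `Summit.Ventures.HSemireg.Wedge.HankelOuter` continued; CHAINED on N517; 0 definitions):
* §1283 **`prod_two_sub_two_mul_cos_add_eq`** (`∏ (2 − 2cos((φ+2πj)∕n)) = 2 − 2cos φ`), **`prod_four_mul_sin_sq_add_eq`** (`∏ 4sin²(θ + πj∕n) = 4sin²(nθ)`), `prod_two_mul_sin_add_shift` (shift rule),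
  **`prod_two_mul_sin_add_eq`** (`∏_{j<n} 2sin(θ + πj∕n) = 2sin(nθ)`, all `θ`), **`sin_nat_mul_eq_pow_mul_prod`** (`sin(nθ) = 2^{n−1} ∏ sin(θ + πj∕n)`), **`prod_two_mul_cos_add_eq_sin`**
  (`∏_{j<n} 2cos(θ + πj∕n) = 2sin(nθ + nπ∕2)`), **`prod_two_mul_sin_add_odd_eq_cos`** (`∏_{j<n} 2sin(θ + (2j+1)π∕2n) = 2cos(nθ)`), **`cos_nat_mul_eq_pow_mul_prod`**.
CAVEATS.  `n ≥ 1`.  Nothing Ext-side.  New names only.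
-/

open Module Polynomial
open scoped Matrix Polynomial

namespace Summit.Ventures.HSemireg.Wedge.HankelOuter

/-! ## §1283. `sin(nθ) = 2^{n−1} ∏ sin(θ + πj∕n)` -/

/-- **`∏_{j<n} (2 − 2cos((φ + 2πj)∕n)) = 2 − 2cos φ`** (`n ≥ 1`, all `φ`; `C_n(2) = 2`). [Gradshteyn–Ryzhik §1.39; this file, §1283] -/
theorem prod_two_sub_two_mul_cos_add_eq {n : ℕ} (hn : n ≠ 0) (φ : ℝ) : ∏ j ∈ Finset.range n, (2 - 2 * Real.cos ((φ + 2 * Real.pi * j) / n)) = 2 - 2 * Real.cos φ := by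
  have h := congrArg (Polynomial.eval (2 : ℝ)) (chebyshevC_sub_C_two_mul_cos_eq_prod_real hn φ)
  rw [eval_sub, eval_C, Polynomial.Chebyshev.C_eval_two, eval_prod] at h
  rw [h]
  exact Finset.prod_congr rfl fun j _ => by rw [eval_sub, eval_X, eval_C]

/-- **`∏_{j<n} 4sin²(θ + πj∕n) = 4sin²(nθ)`** (`n ≥ 1`, all `θ`). [Gradshteyn–Ryzhik §1.39; this file, §1283] -/
theorem prod_four_mul_sin_sq_add_eq {n : ℕ} (hn : n ≠ 0) (θ : ℝ) : ∏ j ∈ Finset.range n, 4 * Real.sin (θ + Real.pi * j / n) ^ 2 = 4 * Real.sin (n * θ) ^ 2 := by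
  have hnR : (n : ℝ) ≠ 0 := by exact_mod_cast hn
  have hterm : ∀ j ∈ Finset.range n, 2 - 2 * Real.cos ((2 * (n * θ) + 2 * Real.pi * j) / n) = 4 * Real.sin (θ + Real.pi * j / n) ^ 2 := fun j _ => by
    rw [show (2 * (n * θ) + 2 * Real.pi * j) / n = 2 * (θ + Real.pi * j / n) by field_simp, Real.cos_two_mul, Real.cos_sq']
    ring
  have h := prod_two_sub_two_mul_cos_add_eq hn (2 * (n * θ))
  rw [Finset.prod_congr rfl hterm, Real.cos_two_mul, Real.cos_sq'] at h
  rw [h]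
  ring

/-- **Shift rule: `∏_{j<n} 2sin(θ + π∕n + πj∕n) = −∏_{j<n} 2sin(θ + πj∕n)`** (`n ≥ 1`; reindex `j ↦ j + 1`, `sin(θ + π) = −sin θ`). [this file, §1283] -/
theorem prod_two_mul_sin_add_shift {n : ℕ} (hn : n ≠ 0) (θ : ℝ) :
    ∏ j ∈ Finset.range n, 2 * Real.sin (θ + Real.pi / n + Real.pi * j / n) = -∏ j ∈ Finset.range n, 2 * Real.sin (θ + Real.pi * j / n) := by
  have hnR : (n : ℝ) ≠ 0 := by exact_mod_cast hn
  set f : ℕ → ℝ := fun j => 2 * Real.sin (θ + Real.pi * j / n) with hf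
  have hlhs : ∏ j ∈ Finset.range n, 2 * Real.sin (θ + Real.pi / n + Real.pi * j / n) = ∏ j ∈ Finset.range n, f (j + 1) :=
    Finset.prod_congr rfl fun j _ => by
      simp only [hf]
      rw [show θ + Real.pi / n + Real.pi * j / n = θ + Real.pi * ((j + 1 : ℕ) : ℝ) / n by push_cast; ring]
  have hfn : f n = -f 0 := by
    simp only [hf, Nat.cast_zero, mul_zero, zero_div, add_zero]
    rw [mul_div_assoc, div_self hnR, mul_one, Real.sin_add_pi, mul_neg]
  have key : (∏ j ∈ Finset.range n, f (j + 1)) * f 0 = -(∏ j ∈ Finset.range n, f j) * f 0 := by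
    rw [← Finset.prod_range_succ' f n, Finset.prod_range_succ, hfn]
    ring
  by_cases h0 : f 0 = 0
  · have h1 : ∏ j ∈ Finset.range n, f j = 0 := Finset.prod_eq_zero (Finset.mem_range.mpr (Nat.pos_of_ne_zero hn)) h0
    have h2 : ∏ j ∈ Finset.range n, f (j + 1) = 0 := by
      refine Finset.prod_eq_zero (Finset.mem_range.mpr (show n - 1 < n by omega)) ?_
      rw [Nat.sub_add_cancel (Nat.one_le_iff_ne_zero.mpr hn), hfn, h0, neg_zero]
    rw [hlhs, h1, h2, neg_zero]
  · rw [hlhs]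
    exact mul_right_cancel₀ h0 key

/-- **THE MULTIPLE-ANGLE SINE PRODUCT: `∏_{j<n} 2sin(θ + πj∕n) = 2sin(nθ)` for every `θ ∈ ℝ`** (`n ≥ 1`). [Gradshteyn–Ryzhik §1.39; Hobson Ch. VII; this file, §1283] -/
theorem prod_two_mul_sin_add_eq {n : ℕ} (hn : n ≠ 0) (θ : ℝ) : ∏ j ∈ Finset.range n, 2 * Real.sin (θ + Real.pi * j / n) = 2 * Real.sin (n * θ) := by
  have hnR : (0 : ℝ) < n := by exact_mod_cast Nat.pos_of_ne_zero hn
  have hnR' : (n : ℝ) ≠ 0 := hnR.ne'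
  -- (1) the identity on the fundamental interval `[0, π/n]`, where both sides are `≥ 0`
  have base : ∀ x ∈ Set.Icc (0 : ℝ) (Real.pi / n), ∏ j ∈ Finset.range n, 2 * Real.sin (x + Real.pi * j / n) = 2 * Real.sin (n * x) := by
    intro x hx
    obtain ⟨hx0, hx1⟩ := hx
    have hxn : (n : ℝ) * x ≤ Real.pi := by rw [le_div_iff₀ hnR] at hx1; linarith
    have hfac : ∀ j ∈ Finset.range n, 0 ≤ 2 * Real.sin (x + Real.pi * j / n) := fun j hj => by
      have hj : (j : ℝ) + 1 ≤ n := by exact_mod_cast Finset.mem_range.mp hj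
      refine mul_nonneg zero_le_two (Real.sin_nonneg_of_nonneg_of_le_pi (by positivity) ?_)
      have hle : Real.pi * j / n ≤ Real.pi - Real.pi / n := by
        rw [div_le_iff₀ hnR, sub_mul, div_mul_cancel₀ _ hnR']
        nlinarith [Real.pi_pos]
      linarith
    have hprod : 0 ≤ ∏ j ∈ Finset.range n, 2 * Real.sin (x + Real.pi * j / n) := Finset.prod_nonneg hfac
    have hrhs : 0 ≤ 2 * Real.sin (n * x) := mul_nonneg zero_le_two (Real.sin_nonneg_of_nonneg_of_le_pi (by positivity) hxn)
    have hsq : (∏ j ∈ Finset.range n, 2 * Real.sin (x + Real.pi * j / n)) ^ 2 = (2 * Real.sin (n * x)) ^ 2 := by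
      rw [← Finset.prod_pow, mul_pow, show (2 : ℝ) ^ 2 * Real.sin (n * x) ^ 2 = 4 * Real.sin (n * x) ^ 2 by norm_num, ← prod_four_mul_sin_sq_add_eq hn x]
      exact Finset.prod_congr rfl fun j _ => by ring
    exact (pow_left_inj₀ hprod hrhs two_ne_zero).mp hsq
  -- (2) shift invariance of the statement
  have hshift : ∀ x : ℝ, (∏ j ∈ Finset.range n, 2 * Real.sin (x + Real.pi * j / n) = 2 * Real.sin (n * x)) ↔
      (∏ j ∈ Finset.range n, 2 * Real.sin (x + Real.pi / n + Real.pi * j / n) = 2 * Real.sin (n * (x + Real.pi / n))) := fun x => by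
    rw [prod_two_mul_sin_add_shift hn x, show (n : ℝ) * (x + Real.pi / n) = n * x + Real.pi by field_simp, Real.sin_add_pi, mul_neg, neg_inj]
  -- (3) all nonnegative and nonpositive integer shifts of the fundamental interval
  have hup : ∀ k : ℕ, ∀ x ∈ Set.Icc (0 : ℝ) (Real.pi / n), ∏ j ∈ Finset.range n, 2 * Real.sin (x + k * (Real.pi / n) + Real.pi * j / n) = 2 * Real.sin (n * (x + k * (Real.pi / n))) := by
    intro k
    induction k with
    | zero => intro x hx; rw [Nat.cast_zero, zero_mul, add_zero]; exact base x hx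
    | succ k ih => intro x hx; rw [Nat.cast_succ, add_mul, one_mul, ← add_assoc]; exact (hshift _).mp (ih x hx)
  have hdown : ∀ k : ℕ, ∀ x ∈ Set.Icc (0 : ℝ) (Real.pi / n), ∏ j ∈ Finset.range n, 2 * Real.sin (x - k * (Real.pi / n) + Real.pi * j / n) = 2 * Real.sin (n * (x - k * (Real.pi / n))) := by
    intro k
    induction k with
    | zero => intro x hx; rw [Nat.cast_zero, zero_mul, sub_zero]; exact base x hx
    | succ k ih =>
      intro x hx
      rw [Nat.cast_succ, add_mul, one_mul, ← sub_sub]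
      refine (hshift _).mpr ?_
      rw [sub_add_cancel]
      exact ih x hx
  -- (4) `θ = x + k π/n` with `x ∈ [0, π/n)`, `k = ⌊θ/(π/n)⌋`
  have hpos : 0 < Real.pi / n := by positivity
  have h1 : ((⌊θ / (Real.pi / n)⌋ : ℤ) : ℝ) * (Real.pi / n) ≤ θ := (le_div_iff₀ hpos).mp (Int.floor_le _)
  have h2 : θ < (((⌊θ / (Real.pi / n)⌋ : ℤ) : ℝ) + 1) * (Real.pi / n) := (div_lt_iff₀ hpos).mp (Int.lt_floor_add_one _)
  have hx : θ - ((⌊θ / (Real.pi / n)⌋ : ℤ) : ℝ) * (Real.pi / n) ∈ Set.Icc (0 : ℝ) (Real.pi / n) := ⟨by linarith, by linarith⟩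
  obtain ⟨m, hm | hm⟩ := Int.eq_nat_or_neg ⌊θ / (Real.pi / n)⌋
  · have h := hup m _ hx
    rw [hm, Int.cast_natCast, sub_add_cancel] at h
    exact h
  · have h := hdown m _ hx
    rw [hm, Int.cast_neg, Int.cast_natCast, neg_mul, sub_neg_eq_add, add_sub_cancel_right] at h
    exact h

/-- **`sin(nθ) = 2^{n−1} ∏_{j<n} sin(θ + πj∕n)`** (`n ≥ 1`, all `θ`). [Gradshteyn–Ryzhik §1.39; this file, §1283] -/
theorem sin_nat_mul_eq_pow_mul_prod {n : ℕ} (hn : n ≠ 0) (θ : ℝ) : Real.sin (n * θ) = 2 ^ (n - 1) * ∏ j ∈ Finset.range n, Real.sin (θ + Real.pi * j / n) := by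
  have h := prod_two_mul_sin_add_eq hn θ
  rw [Finset.prod_mul_distrib, Finset.prod_const, Finset.card_range] at h
  obtain ⟨m, rfl⟩ := Nat.exists_eq_add_one_of_ne_zero hn
  rw [Nat.add_sub_cancel]
  rw [pow_succ] at h
  linarith

/-- **`∏_{j<n} 2cos(θ + πj∕n) = 2sin(nθ + nπ∕2)`** (`n ≥ 1`, all `θ`; `cos x = sin(x + π∕2)`). [Gradshteyn–Ryzhik §1.39; this file, §1283] -/
theorem prod_two_mul_cos_add_eq_sin {n : ℕ} (hn : n ≠ 0) (θ : ℝ) : ∏ j ∈ Finset.range n, 2 * Real.cos (θ + Real.pi * j / n) = 2 * Real.sin (n * θ + n * Real.pi / 2) := by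
  have h := prod_two_mul_sin_add_eq hn (θ + Real.pi / 2)
  rw [mul_add, mul_div_assoc'] at h
  rw [← h]
  exact Finset.prod_congr rfl fun j _ => by rw [show θ + Real.pi / 2 + Real.pi * j / n = θ + Real.pi * j / n + Real.pi / 2 by ring, Real.sin_add_pi_div_two]

/-- **`∏_{j<n} 2sin(θ + (2j+1)π∕2n) = 2cos(nθ)`**, i.e. `cos(nθ) = 2^{n−1} ∏_{j<n} sin(θ + (2j+1)π∕2n)` (`n ≥ 1`, all `θ`; the sine product at `θ + π∕2n`). [Gradshteyn–Ryzhik §1.39; this file, §1283] -/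
theorem prod_two_mul_sin_add_odd_eq_cos {n : ℕ} (hn : n ≠ 0) (θ : ℝ) : ∏ j ∈ Finset.range n, 2 * Real.sin (θ + (2 * j + 1) * Real.pi / (2 * n)) = 2 * Real.cos (n * θ) := by
  have hnR : (n : ℝ) ≠ 0 := by exact_mod_cast hn
  have h := prod_two_mul_sin_add_eq hn (θ + Real.pi / (2 * n))
  rw [mul_add, show (n : ℝ) * (Real.pi / (2 * n)) = Real.pi / 2 by field_simp, Real.sin_add_pi_div_two] at h
  rw [← h]
  exact Finset.prod_congr rfl fun j _ => by rw [show θ + Real.pi / (2 * n) + Real.pi * j / n = θ + (2 * j + 1) * Real.pi / (2 * n) by field_simp; ring]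

/-- **`cos(nθ) = 2^{n−1} ∏_{j<n} sin(θ + (2j+1)π∕2n)`** (`n ≥ 1`, all `θ`). [Gradshteyn–Ryzhik §1.39; this file, §1283] -/
theorem cos_nat_mul_eq_pow_mul_prod {n : ℕ} (hn : n ≠ 0) (θ : ℝ) : Real.cos (n * θ) = 2 ^ (n - 1) * ∏ j ∈ Finset.range n, Real.sin (θ + (2 * j + 1) * Real.pi / (2 * n)) := by
  have h := prod_two_mul_sin_add_odd_eq_cos hn θ
  rw [Finset.prod_mul_distrib, Finset.prod_const, Finset.card_range] at h
  obtain ⟨m, rfl⟩ := Nat.exists_eq_add_one_of_ne_zero hn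
  rw [Nat.add_sub_cancel]
  rw [pow_succ] at h
  linarith

end Summit.Ventures.HSemireg.Wedge.HankelOuter
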